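import Summits.ResolutionOfSingularities.ResolutionOfSingularities.Theorems.PurelyInseparableDim4InScopeWinCert
import Literature.AlgebraicGeometry.Resolution.CentreBlowupOrdAlongBasics
import HarnessLib
import HarnessLib.Audit.Tags

/-!
# Purely inseparable fourfolds — flat absorption, part 1: the attractors depend on `F` only; `p`-th power
# polynomials (written `deletePthPowers p R = 0`)

Census cell «res-dim4-pi» (D-0157 DOOR 2); seat res-rescue-typ-3 g8 (rescue base on loan per director-resolution
DR-E8 (4)); def-free support for the ∀K column of the F4-C instrument (desk WORD #65 (c)).  [OURS · counted 0 ·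
statements about OUR frame-v4 game (`State`, `Edge`, `StateWins`, `InScopeStateWins`) and plain polynomial algebra,
not about resolution.]  CONTEXT: the ∀K certificates of record (res-dim4-p-14's `UCert`/`UICert`) stop wherever the
`q`-fold locus of a chart contains a COORDINATE FLAT of positive dimension (B owns replies with transcendental free
coordinates; measured on the RUN 4b band: 679 / 1 105 roots have such a chart in EVERY permissible first centre).
FLAT ABSORPTION (file `…FlatAbsorb`): those replies are harmless as soon as A's next centre avoids the free coordinates of
the flat, because the coordinate-centre step commutes with translations off the centre.
THIS FILE: §1 `inScopeStateWins_congr` / `stateWins_congr` (the books `r`, `exc` are never read by legality or by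
edges); §2 polynomials killed by cleaning (`deletePthPowers q R = 0`, no new definition): closed under `+`, `−`, `·`,
`^`, `Σ`, monomials with `q`-divisible exponents, constants, `X_i ^ q`; no coefficient in degrees `0 < |d| < q`;
`deletePthPowers q (P + R) = deletePthPowers q P`; what cleaning removes is killed by cleaning.
Nothing here proves resolution of singularities in dimension ≥ 4 / characteristic `p`; F4-C(2,2) stays OPEN.  AI work,
weaker than expert review.  bears_on: LADDER-RESOLUTION:D157-DOOR2 (res-dim4-pi · F4-C ∀K column · flat absorption).
Supports stmt-ResolutionOfSingularities-16155 (helper).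
-/

set_option linter.dupNamespace false

noncomputable section
open MvPolynomial Finset
open scoped BigOperators
namespace Summit.ResolutionOfSingularities.ResolutionOfSingularities.Theorems.PIDim4

namespace FlatAbsorb

open Literature.AlgebraicGeometry.Resolution
open Literature.AlgebraicGeometry.Resolution.Hauser2010
open Literature.AlgebraicGeometry.Resolution.CentreBlowup
open InScopeWinCert

variable {K : Type} [Field K] [DecidableEq K]

/-! ## §1 The attractors depend on `F` only -/

/-- The `F`-component of a step depends only on the `F`-component of the state. [folklore] -/
theorem step_F_congr (q : ℕ) (S : Finset (Fin 4)) (j : Fin 4) (b : Fin 4 → K) {s t : State K}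
    (h : s.F = t.F) : (step q S j b s).F = (step q S j b t).F := by
  show deletePthPowers q (pointTransform q S j b s) = deletePthPowers q (pointTransform q S j b t)
  unfold pointTransform
  rw [h]

omit [DecidableEq K] in
/-- «Equimultiple point» depends only on the `F`-component of the state. [folklore] -/
theorem isEquimultiplePoint_congr (q : ℕ) (S : Finset (Fin 4)) (j : Fin 4) (b : Fin 4 → K) {s t : State K}
    (h : s.F = t.F) : IsEquimultiplePoint q S j b s ↔ IsEquimultiplePoint q S j b t := by
  unfold IsEquimultiplePoint pointTransform
  rw [h]

/-- An edge out of `s` has a twin out of any state with the same `F`, with the same child `F`. [folklore] -/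
theorem edge_congr {q : ℕ} {S : Finset (Fin 4)} {s t s' : State K} (h : s.F = t.F) (he : Edge q S s s') :
    ∃ t', Edge q S t t' ∧ s'.F = t'.F := by
  obtain ⟨j, b, hj, hbj, heq, hne, rfl⟩ := he
  refine ⟨step q S j b t, ⟨j, b, hj, hbj, (isEquimultiplePoint_congr q S j b h).mp heq, ?_, rfl⟩,
    step_F_congr q S j b h⟩
  rwa [← step_F_congr q S j b h]

/-- **The in-scope attractor depends only on `F`.** [folklore] -/
theorem inScopeStateWins_congr {q : ℕ} {s : State K} (hs : InScopeStateWins q s) :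
    ∀ t : State K, t.F = s.F → InScopeStateWins q t := by
  induction hs with
  | terminal hno =>
    intro t ht
    exact Game.Wins.terminal fun S hS => hno S (by rw [← ht]; exact hS)
  | @move x S hm _ ih =>
    intro t ht
    refine Game.Wins.move (m := S) (by rw [ht]; exact hm) fun t' ht' => ?_
    obtain ⟨x', hx', hF⟩ := edge_congr ht ht'
    exact ih x' hx' t' hF

/-- **The full-game attractor depends only on `F`.** [folklore] -/
theorem stateWins_congr {q : ℕ} {s : State K} (hs : StateWins q s) :
    ∀ t : State K, t.F = s.F → StateWins q t := by
  induction hs with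
  | terminal hno =>
    intro t ht
    exact Game.Wins.terminal fun S hS => hno S (by rw [← ht]; exact hS)
  | @move x S hm _ ih =>
    intro t ht
    refine Game.Wins.move (m := S) (by rw [ht]; exact hm) fun t' ht' => ?_
    obtain ⟨x', hx', hF⟩ := edge_congr ht ht'
    exact ih x' hx' t' hF

/-! ## §2 `q`-th power polynomials -/

omit [DecidableEq K] in
/-- «`P` is a sum of `q`-th power monomials» is expressed WITHOUT a new definition as `deletePthPowers q P = 0`
(cleaning kills it); this is the coefficient form. [folklore] -/
theorem deletePthPowers_eq_zero_iff (q : ℕ) (P : MvPolynomial (Fin 4) K) :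
    deletePthPowers q P = 0 ↔ ∀ d, coeff d P ≠ 0 → IsPthPowerExponent q d := by
  constructor
  · intro h d hd
    by_contra hnot
    have := congrArg (coeff d) h
    rw [coeff_deletePthPowers, if_neg hnot, coeff_zero] at this
    exact hd this
  · intro h
    ext d
    rw [coeff_deletePthPowers, coeff_zero]
    split_ifs with hq
    · rfl
    · by_contra hne; exact hq (h d hne)

omit [DecidableEq K] in
/-- `0` is a `q`-th power polynomial. [folklore] -/
theorem isQPow_zero (q : ℕ) : deletePthPowers q (0 : MvPolynomial (Fin 4) K) = 0 := deletePthPowers_zero q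

omit [DecidableEq K] in
/-- Sums of `q`-th power polynomials. [folklore] -/
theorem killed_add {q : ℕ} {P Q : MvPolynomial (Fin 4) K} (hP : deletePthPowers q P = 0) (hQ : deletePthPowers q Q = 0) :
    deletePthPowers q (P + Q) = 0 := by
  rw [deletePthPowers_add, hP, hQ, add_zero]

omit [DecidableEq K] in
/-- Negation. [folklore] -/
theorem killed_neg {q : ℕ} {P : MvPolynomial (Fin 4) K} (hP : deletePthPowers q P = 0) : deletePthPowers q (-P) = 0 := by
  rw [deletePthPowers_eq_zero_iff] at hP ⊢
  intro d hd; rw [coeff_neg, neg_ne_zero] at hd; exact hP d hd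

omit [DecidableEq K] in
/-- Differences. [folklore] -/
theorem killed_sub {q : ℕ} {P Q : MvPolynomial (Fin 4) K} (hP : deletePthPowers q P = 0) (hQ : deletePthPowers q Q = 0) :
    deletePthPowers q (P - Q) = 0 := by
  rw [sub_eq_add_neg]; exact killed_add hP (killed_neg hQ)

omit [DecidableEq K] in
/-- Finite sums. [folklore] -/
theorem killed_sum {q : ℕ} {ι : Type*} (s : Finset ι) {f : ι → MvPolynomial (Fin 4) K}
    (h : ∀ i ∈ s, deletePthPowers q (f i) = 0) : deletePthPowers q (∑ i ∈ s, f i) = 0 := by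
  classical
  induction s using Finset.induction_on with
  | empty => rw [Finset.sum_empty]; exact isQPow_zero q
  | insert a s ha ih =>
    rw [Finset.sum_insert ha]
    exact killed_add (h a (Finset.mem_insert_self a s)) (ih fun i hi => h i (Finset.mem_insert_of_mem hi))

omit [DecidableEq K] in
/-- A monomial with a `q`-th power exponent. [folklore] -/
theorem isQPow_monomial {q : ℕ} {d : Fin 4 →₀ ℕ} (hd : IsPthPowerExponent q d) (c : K) :
    deletePthPowers q (monomial d c) = 0 := by
  classical
  rw [deletePthPowers_eq_zero_iff]
  intro d' hd'
  rw [coeff_monomial] at hd'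
  split_ifs at hd' with h
  · rw [← h]; exact hd
  · exact (hd' rfl).elim

omit [DecidableEq K] in
/-- Products of `q`-th power polynomials. [folklore] -/
theorem killed_mul {q : ℕ} {P Q : MvPolynomial (Fin 4) K} (hP : deletePthPowers q P = 0) (hQ : deletePthPowers q Q = 0) :
    deletePthPowers q (P * Q) = 0 := by
  classical
  rw [deletePthPowers_eq_zero_iff] at hP hQ ⊢
  intro d hd
  rw [coeff_mul] at hd
  obtain ⟨⟨d₁, d₂⟩, hmem, hne⟩ := Finset.exists_ne_zero_of_sum_ne_zero hd
  rw [Finset.mem_antidiagonal] at hmem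
  have h1 : coeff d₁ P ≠ 0 := fun h => hne (by rw [h, zero_mul])
  have h2 : coeff d₂ Q ≠ 0 := fun h => hne (by rw [h, mul_zero])
  rw [isPthPowerExponent_iff] at *
  intro i
  have := hP d₁ h1; have := hQ d₂ h2
  rw [isPthPowerExponent_iff] at *
  rw [← hmem, Finsupp.add_apply]
  exact dvd_add (‹∀ i, q ∣ d₁ i› i) (‹∀ i, q ∣ d₂ i› i)

omit [DecidableEq K] in
/-- Powers. [folklore] -/
theorem killed_pow {q : ℕ} {P : MvPolynomial (Fin 4) K} (hP : deletePthPowers q P = 0) (n : ℕ) : deletePthPowers q (P ^ n) = 0 := by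
  induction n with
  | zero =>
    rw [pow_zero]
    exact isQPow_monomial (d := 0) (fun i hi => by simp at hi) 1
  | succ n ih => rw [pow_succ]; exact killed_mul ih hP

omit [DecidableEq K] in
/-- Constants are `q`-th power polynomials. [folklore] -/
theorem isQPow_C (q : ℕ) (c : K) : deletePthPowers q (C c : MvPolynomial (Fin 4) K) = 0 :=
  isQPow_monomial (d := 0) (fun i hi => by simp at hi) c

omit [DecidableEq K] in
/-- `1` is a `q`-th power polynomial. [folklore] -/
theorem isQPow_one {q : ℕ} : deletePthPowers q (1 : MvPolynomial (Fin 4) K) = 0 := by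
  rw [← C_1]; exact isQPow_C q 1

omit [DecidableEq K] in
/-- `X_i ^ q` is a `q`-th power polynomial. [folklore] -/
theorem isQPow_X_pow (q : ℕ) (i : Fin 4) : deletePthPowers q ((X i : MvPolynomial (Fin 4) K) ^ q) = 0 := by
  classical
  rw [X_pow_eq_monomial]
  refine isQPow_monomial (fun k _ => ?_) 1
  rw [Finsupp.single_apply]
  split_ifs <;> simp

omit [DecidableEq K] in
/-- A `q`-th power polynomial has no coefficient in degrees `0 < |d| < q` (for `0 < q`). [folklore] -/
theorem coeff_eq_zero_of_killed {q : ℕ} {P : MvPolynomial (Fin 4) K} (hP : deletePthPowers q P = 0)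
    {d : Fin 4 →₀ ℕ} (hd0 : d ≠ 0) (hdq : d.degree < q) : coeff d P = 0 := by
  rw [deletePthPowers_eq_zero_iff] at hP
  by_contra h
  have hq := (isPthPowerExponent_iff q d).mp (hP d h)
  obtain ⟨i, hi⟩ : ∃ i, d i ≠ 0 := by
    by_contra hall; push Not at hall; exact hd0 (Finsupp.ext hall)
  have hle : q ≤ d i := Nat.le_of_dvd (Nat.pos_of_ne_zero hi) (hq i)
  have hle' : d i ≤ d.degree := by
    rw [Finsupp.degree_eq_sum]
    exact Finset.single_le_sum (f := fun k => d k) (fun _ _ => Nat.zero_le _) (Finset.mem_univ i)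
  omega

omit [DecidableEq K] in
/-- `deletePthPowers q (P + R) = deletePthPowers q P` for a `q`-th power polynomial `R`. [folklore] -/
theorem deletePthPowers_add_of_isQPow {q : ℕ} (P : MvPolynomial (Fin 4) K) {R : MvPolynomial (Fin 4) K}
    (hR : deletePthPowers q R = 0) : deletePthPowers q (P + R) = deletePthPowers q P := by
  rw [deletePthPowers_add, hR, add_zero]

omit [DecidableEq K] in
/-- What `deletePthPowers` removes is a `q`-th power polynomial: `P = deletePthPowers q P + R`, `R` q-th power.
[folklore] -/
theorem isQPow_sub_deletePthPowers (q : ℕ) (P : MvPolynomial (Fin 4) K) :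
    deletePthPowers q (P - deletePthPowers q P) = 0 := by
  classical
  rw [deletePthPowers_eq_zero_iff]
  intro d hd
  rw [coeff_sub, coeff_deletePthPowers] at hd
  split_ifs at hd with h
  · exact h
  · exact (hd (sub_self _)).elim

end FlatAbsorb

end Summit.ResolutionOfSingularities.ResolutionOfSingularities.Theorems.PIDim4

end
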